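import Summits.ResolutionOfSingularities.ResolutionOfSingularities.Theorems.PurelyInseparableDim4PhiLineVertexPerturbation
import HarnessLib

/-!
# (K-Φ3) label propagation V: cleaning and unit factors are `v`-blind (memo §6.2 (P6), (P7); (I1′))

Cell `res-dim4-pi` (D-0157 DOOR 2), Φ = β_h line of res-dim4-idea-1 (CARD I-1-6/7/8, memo `B-infinity-critical-frame.md` §1 (I1′) «cleaning is
inert on the strip `a₁ < 1`», §6.2 (P6) «cleaning is v-blind», (P7) «unit-insensitivity of vertices»; (K-Φ2) dictionary item «cleaning
confined to `a₁′ ≥ 1`», idea-1 g6 04:06:11Z). Along the chain the polygon laws (`PointBlowupPolygonLaws*Indexed`) speak about the weak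
transform `J″ = (J R′ : u^μ) = (H)` (strict transform `H` of the residual), while the tree's next STATE has residual
`G′ = ε·H + R̃` — `ε` a unit (lost boundary factors) and `R̃ ∈ (u₁′)^d` the cleaning correction (`r_{h′} + d = p`). This file proves, in a
FIXED frame `c` and for every `r`, that such a change of generator does not move the vertex `v = (α, β)` when `α < 1`:

* `isInitialTerm_add_of_mem`, `isInitialTerm_mul_of_isUnit`, `isInitialTerm_mul_left_add` — initial unit terms survive adding an element of
  the next weighted order ideal and multiplying by a unit (representative `C ε · F`);
* **`pts_nonempty_and_alphaS_betaS_eq_of_generator_perturb`** — for principal ideals `(g)`, `(g′)` with `g′ = ε g + ρ`, `ε` a unit and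
  `ρ ∈ F^{w_N}_{(Nαs+βs)μ+1}` for every steep level weight `w_N` of slope `N ≥ N₀ > βs` through `v(g)`: `pts (g′) ≠ ∅`, `αs′ = αs`,
  `βs′ = βs` (steep lines transfer since `g′ ∈ F` iff `g ∈ F` below that level; the vertex point is an initial unit term of `h g`, hence
  of `h g′ = ε (h g) + h ρ`; conclude by `alphaS_betaS_eq_of_steepLines` of FILE I);
* `pow_u1_mem_weightedOrderIdeal_steep_succ` — `u₁^μ ∈ F^{w_N}_{(Nαs+βs)μ+1}` as soon as `μ ≥ 1`, `αs < μ!` and `N > βs`;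
* **`pts_nonempty_and_alphaS_betaS_eq_of_cleaning`** / `alphaS_eq_of_cleaning` / `betaS_eq_of_cleaning` — the instance `ρ ∈ (u₁^μ)`,
  `α < 1`: «cleaning (and the unit `ε`) do not move `v`».

`δ` is NOT claimed invariant here (a cleaning term may sit below the `δ`-line but right of `x₁ = 1`); `δ′ > 1` for the child is the route
of FILES III/IV (`killVars_eq_self_of_label_hypotheses` + `factorial_lt_deltaS_iff`). [OURS · counted 0 · AI work weaker than expert
review.] Nothing here proves K2(p), the β_h line, or resolution of singularities in dimension ≥ 4 / characteristic p.

Sources: V. Cossart, U. Jannsen, S. Saito, LNM **2270** (2020), Def. 8.2, Lemma 8.3 (4), Def. 11.1 [`CossartJannsenSaito2020`]; V. Cossart,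
O. Piltant, J. Algebra 320 (2008), §4 p. 10 (the exponent set `E` is insensitive to unit coefficients) [`CossartPiltant2008`].
-/

noncomputable section

open IsLocalRing MvPolynomial
open Literature.AlgebraicGeometry.Resolution (weightedOrderIdeal weightedOrderIdeal_antitone weightedOrderIdeal_mul_le
  weightedOrderIdeal_pow_le apply_mem_weightedOrderIdeal)
open Literature.AlgebraicGeometry.Resolution.WeightedOrder

set_option linter.dupNamespace false

namespace Summit.ResolutionOfSingularities.ResolutionOfSingularities.Theorems.PIDim4.PhiLine

universe u v

/-! ## Initial unit terms under `f ↦ ε f + ρ` -/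

section Generic

variable {R : Type u} [CommRing R] {σ : Type v} (c : σ → R) (w : σ → ℕ)

/-- Adding an element of `F_{⟨w,e⟩+1}` does not change the initial unit term `e`. [cite: CossartJannsenSaito2020, Def. 8.2] -/
theorem isInitialTerm_add_of_mem {f g : R} {e : σ →₀ ℕ} (hf : IsInitialTerm c w f e)
    (hg : g ∈ weightedOrderIdeal c w (Finsupp.weight w e + 1)) : IsInitialTerm c w (f + g) e := by
  obtain ⟨F, hF, hFu, hrem⟩ := hf
  refine ⟨F, hF, hFu, ?_⟩
  have hsplit : f + g - eval c F = (f - eval c F) + g := by ring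
  rw [hsplit]
  exact Ideal.add_mem _ hrem hg

/-- Multiplying by a unit does not change the initial unit term `e` (representative `C ε · F`: coefficient `ε · coeff_e F` is a unit).
[cite: CossartPiltant2008, §4 p. 10] -/
theorem isInitialTerm_mul_of_isUnit {f ε : R} {e : σ →₀ ℕ} (hε : IsUnit ε) (hf : IsInitialTerm c w f e) :
    IsInitialTerm c w (ε * f) e := by
  obtain ⟨F, hF, hFu, hrem⟩ := hf
  refine ⟨C ε * F, ?_, ?_, ?_⟩
  · intro m hm
    rw [coeff_C_mul] at hm
    exact hF (right_ne_zero_of_mul hm)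
  · rw [coeff_C_mul]; exact hε.mul hFu
  · rw [map_mul, eval_C, ← mul_sub]
    exact Ideal.mul_mem_left _ _ hrem

/-- `h g′` has the initial unit term of `h g` when `g′ = ε g + ρ`, `ε` a unit, `h ρ ∈ F_{⟨w,e⟩+1}`. [cite: CossartJannsenSaito2020, Def. 8.2] -/
theorem isInitialTerm_mul_left_add {g ρ ε h : R} {e : σ →₀ ℕ} (hε : IsUnit ε) (hf : IsInitialTerm c w (h * g) e)
    (hρ : h * ρ ∈ weightedOrderIdeal c w (Finsupp.weight w e + 1)) : IsInitialTerm c w (h * (ε * g + ρ)) e := by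
  have hsplit : h * (ε * g + ρ) = ε * (h * g) + h * ρ := by ring
  rw [hsplit]
  exact isInitialTerm_add_of_mem c w (isInitialTerm_mul_of_isUnit c w hε hf) hρ

end Generic

/-! ## The vertex of a principal ideal under `g ↦ ε g + ρ` with `ρ` above every steep line through `v` -/

section Steep

variable {R : Type u} [CommRing R] [IsRegularLocalRing R] {r : ℕ} (c : Fin (r + 2) → R)
  (hgen : Ideal.span (Set.range c) = maximalIdeal R) (hdim : ringKrullDim R = r + 2) {μ : ℕ}

include hgen hdim in
/-- **The vertex is blind to `g ↦ ε g + ρ` for `ρ` strictly above the steep lines.** For `J = (g) ⊆ 𝔪^μ` with non-empty polygon and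
`N₀ > βs`: if `ε` is a unit and `ρ ∈ F^{w_N}_{(Nαs+βs)μ+1}(c)` for every steep level weight `w_N = (Nαs+βs, …, L N, L)` of slope
`N ≥ N₀`, then `(ε g + ρ)` has a non-empty polygon with the same `αs`, `βs`. [cite: CossartJannsenSaito2020, Lemma 8.3 (4)]
[cite: CossartPiltant2008, §4 p. 10] -/
theorem pts_nonempty_and_alphaS_betaS_eq_of_generator_perturb {g ρ ε : R} (hε : IsUnit ε)
    (hJμ : Ideal.span {g} ≤ maximalIdeal R ^ μ) (hne : (pts c (Ideal.span {g}) μ).Nonempty) {N₀ : ℕ}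
    (hN₀ : betaS c (Ideal.span {g}) μ < N₀)
    (hρ : ∀ N, N₀ ≤ N → ρ ∈ weightedOrderIdeal c
      (levelWeight μ (N * alphaS c (Ideal.span {g}) μ + betaS c (Ideal.span {g}) μ) N 1)
      ((N * alphaS c (Ideal.span {g}) μ + betaS c (Ideal.span {g}) μ) * μ + 1)) :
    (pts c (Ideal.span {ε * g + ρ}) μ).Nonempty ∧ alphaS c (Ideal.span {ε * g + ρ}) μ = alphaS c (Ideal.span {g}) μ ∧
      betaS c (Ideal.span {ε * g + ρ}) μ = betaS c (Ideal.span {g}) μ := by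
  set J := Ideal.span {g} with hJ
  set α := alphaS c J μ with hα
  set β := betaS c J μ with hβ
  -- (1) steep lines of `J` transfer to `(ε g + ρ)`
  have hsteep : ∀ N, N₀ ≤ N → ∀ e ∈ pts c (Ideal.span {ε * g + ρ}) μ, N * α + β ≤ N * spt₁ μ e + 1 * spt₂ μ e := by
    intro N hN
    have hNpos : 0 < N := by omega
    have hw₀ := levelWeight_steep_pos c hgen hdim hJμ hne hNpos
    have h1 := (le_weightedOrderIdeal_levelWeight_iff c hgen hdim J hw₀ hNpos Nat.one_pos).mpr (forall_pts_steepLine (by omega))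
    have hg : g ∈ weightedOrderIdeal c (levelWeight μ (N * α + β) N 1) ((N * α + β) * μ) := h1 (Ideal.subset_span rfl)
    have hg' : ε * g + ρ ∈ weightedOrderIdeal c (levelWeight μ (N * α + β) N 1) ((N * α + β) * μ) :=
      Ideal.add_mem _ (Ideal.mul_mem_left _ _ hg) (weightedOrderIdeal_antitone c _ (Nat.le_succ _) (hρ N hN))
    exact (le_weightedOrderIdeal_levelWeight_iff c hgen hdim _ hw₀ hNpos Nat.one_pos).mp
      ((Ideal.span_singleton_le_iff_mem _).mpr hg')
  -- (2) the vertex point of `J` is a Newton point of `(ε g + ρ)`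
  obtain ⟨e, he, h1, h2⟩ := exists_pts_v hne
  have hN₀pos : 0 < N₀ := by omega
  have hmin : ∀ x ∈ pts c J μ, N₀ * spt₁ μ e + 1 * spt₂ μ e ≤ N₀ * spt₁ μ x + 1 * spt₂ μ x := by
    intro x hx
    have h := forall_pts_steepLine (c := c) (J := J) (μ := μ) hN₀ x hx
    rw [h1, h2]
    omega
  have hw₀ : N₀ * spt₁ μ e + 1 * spt₂ μ e = N₀ * α + β := by rw [h1, h2, one_mul]
  have hpos : 0 < N₀ * spt₁ μ e + 1 * spt₂ μ e := by rw [hw₀]; exact levelWeight_steep_pos c hgen hdim hJμ hne hN₀pos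
  obtain ⟨f, hf, hinit⟩ := exists_isInitialTerm_levelWeight_of_isMinOn c hgen hdim hN₀pos Nat.one_pos he hmin hpos
  rw [hw₀] at hinit
  obtain ⟨h, rfl⟩ := Ideal.mem_span_singleton'.mp hf
  have hwt : Finsupp.weight (levelWeight μ (N₀ * α + β) N₀ 1) e = (N₀ * α + β) * μ := by
    have := weight_levelWeight_self (r := r) he.2 N₀ 1
    rw [hw₀] at this
    exact this
  have hinit' : IsInitialTerm c (levelWeight μ (N₀ * α + β) N₀ 1) (h * (ε * g + ρ)) e := by
    refine isInitialTerm_mul_left_add c _ hε hinit ?_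
    rw [hwt]
    exact Ideal.mul_mem_left _ _ (hρ N₀ le_rfl)
  have he' : e ∈ pts c (Ideal.span {ε * g + ρ}) μ :=
    ⟨⟨h * (ε * g + ρ), Ideal.mul_mem_left _ _ (Ideal.subset_span rfl), _, levelWeight_pos (hw₀ ▸ hpos) hN₀pos Nat.one_pos, hinit'⟩,
      he.2⟩
  exact ⟨⟨e, he'⟩, alphaS_betaS_eq_of_steepLines (c := c) (J := J) (N₀ := N₀) hsteep he' h1 h2⟩

omit [IsRegularLocalRing R] in
/-- `u₁^μ` lies strictly above every steep line of slope `N > βs` through `v` once `αs < μ!` (`α < 1`): its weight `μ·L·N` exceeds the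
level `(Nαs+βs)μ`. [cite: CossartJannsenSaito2020, Def. 11.1] -/
theorem pow_u1_mem_weightedOrderIdeal_steep_succ (hμ : 0 < μ) {αs βs N : ℕ} (hα : αs < μ.factorial) (hN : βs < N) :
    c (u1 r) ^ μ ∈ weightedOrderIdeal c (levelWeight μ (N * αs + βs) N 1) ((N * αs + βs) * μ + 1) := by
  have h := weightedOrderIdeal_pow_le c (levelWeight μ (N * αs + βs) N 1) _ μ
    (Ideal.pow_mem_pow (apply_mem_weightedOrderIdeal c (levelWeight μ (N * αs + βs) N 1) (u1 r)) μ)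
  refine weightedOrderIdeal_antitone c _ ?_ h
  rw [levelWeight_u1]
  have h1 : N * (αs + 1) ≤ N * μ.factorial := Nat.mul_le_mul_left N hα
  have h2 : (N * αs + βs) + 1 ≤ μ.factorial * N := by nlinarith
  calc (N * αs + βs) * μ + 1 ≤ ((N * αs + βs) + 1) * μ := by nlinarith
    _ ≤ μ * (μ.factorial * N) := by rw [Nat.mul_comm]; exact Nat.mul_le_mul_left μ h2

include hgen hdim in
/-- **Cleaning and units do not move `v` (memo (P6), (P7), (I1′)).** For `J = (g) ⊆ 𝔪^μ` with non-empty polygon and `α < 1`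
(`αs < μ!`): if `ε` is a unit and `ρ ∈ (u₁^μ)`, then `(ε g + ρ)` has a non-empty polygon with the same `αs`, `βs`. (Chain reading: the
next state's residual `G′ = ε H + R̃`, `R̃ ∈ (x_{h′})^{p − r_{h′}} = (u₁′)^d`, has the vertex of the weak transform `(H)`.)
[cite: CossartJannsenSaito2020, Lemma 8.3 (4)] [cite: CossartPiltant2008, §4 p. 10] -/
theorem pts_nonempty_and_alphaS_betaS_eq_of_cleaning {g ρ ε : R} (hε : IsUnit ε) (hJμ : Ideal.span {g} ≤ maximalIdeal R ^ μ)
    (hne : (pts c (Ideal.span {g}) μ).Nonempty) (hα : alphaS c (Ideal.span {g}) μ < μ.factorial)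
    (hρ : ρ ∈ Ideal.span {c (u1 r) ^ μ}) :
    (pts c (Ideal.span {ε * g + ρ}) μ).Nonempty ∧ alphaS c (Ideal.span {ε * g + ρ}) μ = alphaS c (Ideal.span {g}) μ ∧
      betaS c (Ideal.span {ε * g + ρ}) μ = betaS c (Ideal.span {g}) μ := by
  have hμ : 0 < μ := by obtain ⟨e, he⟩ := hne; have := he.2; omega
  refine pts_nonempty_and_alphaS_betaS_eq_of_generator_perturb c hgen hdim hε hJμ hne (N₀ := betaS c (Ideal.span {g}) μ + 1)
    (Nat.lt_succ_self _) fun N hN => ?_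
  obtain ⟨a, rfl⟩ := Ideal.mem_span_singleton'.mp hρ
  exact Ideal.mul_mem_left _ _ (pow_u1_mem_weightedOrderIdeal_steep_succ c hμ hα (by omega))

include hgen hdim in
/-- `α` is blind to cleaning and units (`α < 1`). [cite: CossartPiltant2008, §4 p. 10] -/
theorem alphaS_eq_of_cleaning {g ρ ε : R} (hε : IsUnit ε) (hJμ : Ideal.span {g} ≤ maximalIdeal R ^ μ)
    (hne : (pts c (Ideal.span {g}) μ).Nonempty) (hα : alphaS c (Ideal.span {g}) μ < μ.factorial) (hρ : ρ ∈ Ideal.span {c (u1 r) ^ μ}) :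
    alphaS c (Ideal.span {ε * g + ρ}) μ = alphaS c (Ideal.span {g}) μ :=
  (pts_nonempty_and_alphaS_betaS_eq_of_cleaning c hgen hdim hε hJμ hne hα hρ).2.1

include hgen hdim in
/-- `β` is blind to cleaning and units (`α < 1`). [cite: CossartPiltant2008, §4 p. 10] -/
theorem betaS_eq_of_cleaning {g ρ ε : R} (hε : IsUnit ε) (hJμ : Ideal.span {g} ≤ maximalIdeal R ^ μ)
    (hne : (pts c (Ideal.span {g}) μ).Nonempty) (hα : alphaS c (Ideal.span {g}) μ < μ.factorial) (hρ : ρ ∈ Ideal.span {c (u1 r) ^ μ}) :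
    betaS c (Ideal.span {ε * g + ρ}) μ = betaS c (Ideal.span {g}) μ :=
  (pts_nonempty_and_alphaS_betaS_eq_of_cleaning c hgen hdim hε hJμ hne hα hρ).2.2

end Steep

end Summit.ResolutionOfSingularities.ResolutionOfSingularities.Theorems.PIDim4.PhiLine

end
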